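import Mathlib
import HarnessLib

/-!
# Relative minima of a fractional ideal of a cubic field of signature (1,1) (Voronoi)

Topic `Literature/NumberTheory/CubicFields`. The first half of Voronoi's theory (1896) of relative
minima for a cubic number field `K` with ONE real embedding `σ₁ : K →+* ℝ` and a NON-REAL embedding
`σ₂ : K →+* ℂ` (unit rank one), as presented in Delone–Faddeev, *The theory of irrationalities of
the third degree* (1964), Ch. IV, and used by the Voronoi / Buchmann–Williams algorithms for the
regulator and the class group of a complex cubic field:

* `embedding_cases` — the complex embeddings of `K` are `σ₁`, `σ₂`, `conj ∘ σ₂`;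
  `norm_eq_mul_norm_sq` — `N_{K/ℚ}(x) = σ₁ x · ‖σ₂ x‖²`;
* `finite_mem_bounded` — a fractional ideal `I` has finitely many elements in a box
  `|σ₁ x| ≤ A`, `‖σ₂ x‖ ≤ B` (discreteness);
* `relMinima σ₁ σ₂ I` — the RELATIVE MINIMA of `I`: the nonzero `θ ∈ I` whose open normed body
  `{|σ₁ φ| < |σ₁ θ|, ‖σ₂ φ‖ < ‖σ₂ θ‖}` contains no nonzero point of `I`;
* `exists_mem_relMinima_le`, `exists_mem_relMinima_pos_le` — below every nonzero point of `I`
  there is a relative minimum (with `σ₁ > 0` after a sign change);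
* `eq_or_eq_neg_of_norm_eq` — no ties: `‖σ₂ θ'‖ = ‖σ₂ θ‖` forces `θ' = ±θ` (the quotient has norm
  `σ₁`-value rational of absolute value `1`);
* `relMinima_lt_iff` — the minima with `σ₁ > 0` are totally ordered: `σ₁` increases exactly when
  `‖σ₂ ·‖` decreases;
* `unit_mul_mem_relMinima` — units of `𝓞 K` act on the minima.

The chain structure (successor, two-sided chain, completeness) is in `VoronoiChain.lean`.
Design: everything is stated for a `FractionalIdeal (nonZeroDivisors (𝓞 K)) K` and a pair of ring
homomorphisms `σ₁`, `σ₂` with the hypotheses `Module.finrank ℚ K = 3` and `∃ z, conj (σ₂ z) ≠ σ₂ z`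
carried explicitly (no bundling), so that users quantifying over all cubic fields can apply the
lemmas verbatim. Not here: reduced ideals, Voronoi's algorithm for computing the successor.

## References

* G. Voronoi, *On a generalization of the algorithm of continued fractions* (1896).
* B. N. Delone, D. K. Faddeev, *The theory of irrationalities of the third degree*, Transl. Math.
  Monographs 10, AMS (1964), Ch. IV.
* H. C. Williams, G. W. Dueck, B. K. Schmid, *A rapid method of evaluating the regulator and class
  number of a pure cubic field*, Math. Comp. 41 (1983), §§2–3.
-/

namespace Literature.NumberTheory.CubicFields

open scoped NumberField ComplexConjugate
open NumberField

section Embeddings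

variable {K : Type*} [Field K] (σ₁ : K →+* ℝ) (σ₂ : K →+* ℂ)

/-- The real embedding seen as a complex one. [folklore] -/
theorem conjugate_ofReal_comp : ComplexEmbedding.conjugate ((algebraMap ℝ ℂ).comp σ₁) = (algebraMap ℝ ℂ).comp σ₁ :=
  RingHom.ext fun x => by simp [ComplexEmbedding.conjugate_coe_eq, Complex.conj_ofReal]

/-- A non-real embedding is not fixed by conjugation. [folklore] -/
theorem conjugate_ne_self (hσ₂ : ∃ z : K, starRingEnd ℂ (σ₂ z) ≠ σ₂ z) :
    ComplexEmbedding.conjugate σ₂ ≠ σ₂ := by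
  obtain ⟨z, hz⟩ := hσ₂
  intro h
  exact hz (by simpa only [ComplexEmbedding.conjugate_coe_eq] using RingHom.congr_fun h z)

/-- **The three complex embeddings of a cubic field of signature (1,1)**: `σ₁` (as a complex
embedding), `σ₂` and `conj ∘ σ₂`. [folklore] -/
theorem embedding_cases [NumberField K] (hdeg : Module.finrank ℚ K = 3) (hσ₂ : ∃ z : K, starRingEnd ℂ (σ₂ z) ≠ σ₂ z)
    (φ : K →+* ℂ) :
    φ = (algebraMap ℝ ℂ).comp σ₁ ∨ φ = σ₂ ∨ φ = ComplexEmbedding.conjugate σ₂ := by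
  classical
  have hne := conjugate_ne_self σ₂ hσ₂
  have h1 : (algebraMap ℝ ℂ).comp σ₁ ≠ σ₂ := by
    intro h; apply hne; rw [← h]; exact conjugate_ofReal_comp σ₁
  have h2 : (algebraMap ℝ ℂ).comp σ₁ ≠ ComplexEmbedding.conjugate σ₂ := by
    intro h; apply h1
    have h' := congrArg ComplexEmbedding.conjugate h
    have hinv : ComplexEmbedding.conjugate (ComplexEmbedding.conjugate σ₂) = σ₂ := star_star σ₂
    rw [conjugate_ofReal_comp σ₁, hinv] at h'
    exact h'
  let S : Finset (K →+* ℂ) := {(algebraMap ℝ ℂ).comp σ₁, σ₂, ComplexEmbedding.conjugate σ₂}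
  have hcard : S.card = Fintype.card (K →+* ℂ) := by
    rw [NumberField.Embeddings.card, hdeg]
    simp only [S]
    rw [Finset.card_insert_of_notMem, Finset.card_insert_of_notMem, Finset.card_singleton]
    · simpa using hne.symm
    · simp only [Finset.mem_insert, Finset.mem_singleton, not_or]; exact ⟨h1, h2⟩
  have huniv := Finset.eq_univ_of_card S hcard
  have hφ : φ ∈ S := by rw [huniv]; exact Finset.mem_univ φ
  simpa [S] using hφ

/-- **The norm in signature (1,1)**: `N(x) = σ₁ x · ‖σ₂ x‖²` (as real numbers). [folklore] -/
theorem norm_eq_mul_norm_sq [NumberField K] (hdeg : Module.finrank ℚ K = 3) (hσ₂ : ∃ z : K, starRingEnd ℂ (σ₂ z) ≠ σ₂ z)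
    (x : K) : ((Algebra.norm ℚ x : ℚ) : ℝ) = σ₁ x * ‖σ₂ x‖ ^ 2 := by
  classical
  have hne := conjugate_ne_self σ₂ hσ₂
  have hprod := Algebra.norm_eq_prod_embeddings ℚ ℂ x
  -- reindex the product by ring homomorphisms
  rw [← (RingHom.equivRatAlgHom (R := K) (S := ℂ)).prod_comp fun σ : K →ₐ[ℚ] ℂ => σ x] at hprod
  simp only [RingHom.equivRatAlgHom_apply, RingHom.toRatAlgHom_apply] at hprod
  -- the universe of embeddings is `{σ₁, σ₂, conj σ₂}`
  have h1 : (algebraMap ℝ ℂ).comp σ₁ ≠ σ₂ := by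
    intro h; apply hne; rw [← h]; exact conjugate_ofReal_comp σ₁
  have h2 : (algebraMap ℝ ℂ).comp σ₁ ≠ ComplexEmbedding.conjugate σ₂ := by
    intro h; apply h1
    have h' := congrArg ComplexEmbedding.conjugate h
    have hinv : ComplexEmbedding.conjugate (ComplexEmbedding.conjugate σ₂) = σ₂ := star_star σ₂
    rw [conjugate_ofReal_comp σ₁, hinv] at h'
    exact h'
  have huniv : (Finset.univ : Finset (K →+* ℂ)) =
      {(algebraMap ℝ ℂ).comp σ₁, σ₂, ComplexEmbedding.conjugate σ₂} := by
    symm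
    apply Finset.eq_univ_of_card
    rw [NumberField.Embeddings.card, hdeg]
    rw [Finset.card_insert_of_notMem, Finset.card_insert_of_notMem, Finset.card_singleton]
    · simpa using hne.symm
    · simp only [Finset.mem_insert, Finset.mem_singleton, not_or]; exact ⟨h1, h2⟩
  rw [huniv, Finset.prod_insert (by simp only [Finset.mem_insert, Finset.mem_singleton, not_or]; exact ⟨h1, h2⟩),
    Finset.prod_insert (by simpa using hne.symm), Finset.prod_singleton] at hprod
  -- read the identity in `ℂ` and take real parts
  have hq : (algebraMap ℚ ℂ) (Algebra.norm ℚ x) = (((Algebra.norm ℚ x : ℚ) : ℝ) : ℂ) := by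
    simp [Complex.ofReal_ratCast]
  rw [hq] at hprod
  simp only [RingHom.coe_comp, Function.comp_apply, ComplexEmbedding.conjugate_coe_eq] at hprod
  have hmc : σ₂ x * (starRingEnd ℂ) (σ₂ x) = ((‖σ₂ x‖ ^ 2 : ℝ) : ℂ) := by
    rw [Complex.mul_conj, Complex.normSq_eq_norm_sq, Complex.ofReal_pow]
  rw [hmc, Complex.coe_algebraMap] at hprod
  have : (((Algebra.norm ℚ x : ℚ) : ℝ) : ℂ) = ((σ₁ x * ‖σ₂ x‖ ^ 2 : ℝ) : ℂ) := by
    rw [hprod]; push_cast; rfl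
  exact_mod_cast this

end Embeddings

section Minima

variable {K : Type*} [Field K] [NumberField K] (σ₁ : K →+* ℝ) (σ₂ : K →+* ℂ)

/-- **Finiteness**: the elements of a fractional ideal whose two conjugates `σ₁`, `σ₂` are bounded
form a finite set (clear denominators, then `NumberField.Embeddings.finite_of_norm_le`). [folklore] -/
theorem finite_mem_bounded (hdeg : Module.finrank ℚ K = 3) (hσ₂ : ∃ z : K, starRingEnd ℂ (σ₂ z) ≠ σ₂ z)
    (I : FractionalIdeal (nonZeroDivisors (𝓞 K)) K) (A B : ℝ) :
    {x : K | x ∈ I ∧ |σ₁ x| ≤ A ∧ ‖σ₂ x‖ ≤ B}.Finite := by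
  classical
  obtain ⟨a, ha, hint⟩ := I.isFractional
  have ha0 : (algebraMap (𝓞 K) K a) ≠ 0 := RingOfIntegers.coe_ne_zero_iff.mpr (nonZeroDivisors.ne_zero ha)
  set Ca : ℝ := max |σ₁ (algebraMap (𝓞 K) K a)| ‖σ₂ (algebraMap (𝓞 K) K a)‖ with hCa
  set T : Set K := {y : K | IsIntegral ℤ y ∧ ∀ φ : K →+* ℂ, ‖φ y‖ ≤ Ca * max A B} with hT
  have hTfin : T.Finite := NumberField.Embeddings.finite_of_norm_le K ℂ (Ca * max A B)
  refine (hTfin.image fun y => (algebraMap (𝓞 K) K a)⁻¹ * y).subset ?_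
  rintro x ⟨hxI, hxA, hxB⟩
  refine ⟨algebraMap (𝓞 K) K a * x, ⟨?_, ?_⟩, by field_simp⟩
  · -- integrality: `a x ∈ 𝓞 K`
    obtain ⟨z, hz⟩ := hint x ((FractionalIdeal.mem_coe).mpr hxI)
    rw [Algebra.smul_def] at hz
    rw [← hz]
    exact RingOfIntegers.isIntegral_coe z
  · intro φ
    have hAB : max |σ₁ x| ‖σ₂ x‖ ≤ max A B := max_le_max hxA hxB
    have hCa0 : 0 ≤ Ca := le_max_of_le_left (abs_nonneg _)
    have hx0 : 0 ≤ max |σ₁ x| ‖σ₂ x‖ := le_max_of_le_left (abs_nonneg _)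
    have key : ‖φ (algebraMap (𝓞 K) K a)‖ * ‖φ x‖ ≤ Ca * max |σ₁ x| ‖σ₂ x‖ := by
      rcases embedding_cases σ₁ σ₂ hdeg hσ₂ φ with rfl | rfl | rfl
      · simp only [RingHom.coe_comp, Function.comp_apply, Complex.coe_algebraMap, Complex.norm_real,
          Real.norm_eq_abs]
        exact mul_le_mul (le_max_left _ _) (le_max_left _ _) (abs_nonneg _) hCa0
      · exact mul_le_mul (le_max_right _ _) (le_max_right _ _) (norm_nonneg _) hCa0
      · simp only [ComplexEmbedding.conjugate_coe_eq, Complex.norm_conj]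
        exact mul_le_mul (le_max_right _ _) (le_max_right _ _) (norm_nonneg _) hCa0
    rw [map_mul, norm_mul]
    exact key.trans (mul_le_mul_of_nonneg_left hAB hCa0)

/-- **The relative minima** of the fractional ideal `I` (for the conjugate pair `σ₁`, `σ₂`;
Voronoi 1896, Delone–Faddeev Ch. IV): the nonzero `θ ∈ I` such that no nonzero `φ ∈ I` has both
`|σ₁ φ| < |σ₁ θ|` and `‖σ₂ φ‖ < ‖σ₂ θ‖` (the open normed body of `θ` contains no nonzero point
of `I`). [folklore] -/
def relMinima (I : FractionalIdeal (nonZeroDivisors (𝓞 K)) K) : Set K :=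
  {θ | θ ∈ I ∧ θ ≠ 0 ∧ ∀ φ ∈ I, φ ≠ 0 → |σ₁ φ| < |σ₁ θ| → ‖σ₂ θ‖ ≤ ‖σ₂ φ‖}

variable {σ₁ σ₂} {I : FractionalIdeal (nonZeroDivisors (𝓞 K)) K}

omit [NumberField K] in
/-- Minima come in pairs `±θ`. [folklore] -/
theorem neg_mem_relMinima {θ : K} (h : θ ∈ relMinima σ₁ σ₂ I) : -θ ∈ relMinima σ₁ σ₂ I := by
  refine ⟨FractionalIdeal.mem_coe.mp (Submodule.neg_mem _ (FractionalIdeal.mem_coe.mpr h.1)),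
    neg_ne_zero.mpr h.2.1, fun φ hφ h0 hlt => ?_⟩
  rw [map_neg, norm_neg]
  rw [map_neg, abs_neg] at hlt
  exact h.2.2 φ hφ h0 hlt

/-- **Existence of a minimum below a point**: every nonzero `x ∈ I` dominates-or-equals a relative
minimum (a `|σ₁|`-least element of the finite set of nonzero points of `I` in the closed normed body
of `x`). [folklore] -/
theorem exists_mem_relMinima_le (hdeg : Module.finrank ℚ K = 3) (hσ₂ : ∃ z : K, starRingEnd ℂ (σ₂ z) ≠ σ₂ z)
    {x : K} (hx : x ∈ I) (hx0 : x ≠ 0) :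
    ∃ μ : K, μ ∈ relMinima σ₁ σ₂ I ∧ |σ₁ μ| ≤ |σ₁ x| ∧ ‖σ₂ μ‖ ≤ ‖σ₂ x‖ := by
  set F : Set K := {ψ : K | ψ ∈ I ∧ |σ₁ ψ| ≤ |σ₁ x| ∧ ‖σ₂ ψ‖ ≤ ‖σ₂ x‖} ∩ {ψ | ψ ≠ 0} with hF
  have hFfin : F.Finite := (finite_mem_bounded σ₁ σ₂ hdeg hσ₂ I |σ₁ x| ‖σ₂ x‖).inter_of_left _
  have hxF : x ∈ F := ⟨⟨hx, le_rfl, le_rfl⟩, hx0⟩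
  obtain ⟨μ, hμF, hmin⟩ := Set.exists_min_image F (fun ψ => |σ₁ ψ|) hFfin ⟨x, hxF⟩
  obtain ⟨⟨hμI, hμ1, hμ2⟩, hμ0⟩ := hμF
  refine ⟨μ, ⟨hμI, hμ0, fun φ hφ h0 hlt => ?_⟩, hμ1, hμ2⟩
  by_contra hcon
  push Not at hcon
  have hφF : φ ∈ F := ⟨⟨hφ, hlt.le.trans hμ1, hcon.le.trans hμ2⟩, h0⟩
  exact absurd (hmin φ hφF) (not_le.mpr hlt)

/-- The same with `σ₁ μ > 0` (replace `μ` by `−μ` if necessary). [folklore] -/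
theorem exists_mem_relMinima_pos_le (hdeg : Module.finrank ℚ K = 3) (hσ₂ : ∃ z : K, starRingEnd ℂ (σ₂ z) ≠ σ₂ z)
    {x : K} (hx : x ∈ I) (hx0 : x ≠ 0) :
    ∃ μ : K, μ ∈ relMinima σ₁ σ₂ I ∧ 0 < σ₁ μ ∧ σ₁ μ ≤ |σ₁ x| ∧ ‖σ₂ μ‖ ≤ ‖σ₂ x‖ := by
  obtain ⟨μ, hμ, h1, h2⟩ := exists_mem_relMinima_le hdeg hσ₂ hx hx0
  have hμ0 : σ₁ μ ≠ 0 := (map_ne_zero σ₁).mpr hμ.2.1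
  rcases lt_or_gt_of_ne hμ0 with hneg | hpos
  · refine ⟨-μ, neg_mem_relMinima hμ, ?_, ?_, ?_⟩
    · rw [map_neg]; linarith
    · rw [map_neg]; rw [abs_of_neg hneg] at h1; exact h1
    · rw [map_neg, norm_neg]; exact h2
  · exact ⟨μ, hμ, hpos, (le_abs_self _).trans h1, h2⟩

/-- **No ties in `‖σ₂ ·‖`**: two nonzero elements with the same `‖σ₂ ·‖` are equal up to sign
(their quotient `u` has `‖σ₂ u‖ = 1`, so `N(u) = σ₁ u` is rational, hence `u` is rational of absolute
value `1`). [folklore] -/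
theorem eq_or_eq_neg_of_norm_eq (σ₁ : K →+* ℝ) (hdeg : Module.finrank ℚ K = 3) (hσ₂ : ∃ z : K, starRingEnd ℂ (σ₂ z) ≠ σ₂ z)
    {θ θ' : K} (hθ : θ ≠ 0) (h : ‖σ₂ θ'‖ = ‖σ₂ θ‖) : θ' = θ ∨ θ' = -θ := by
  have hσθ : σ₂ θ ≠ 0 := (map_ne_zero σ₂).mpr hθ
  set u : K := θ' * θ⁻¹ with hu
  have hθ' : θ' = u * θ := by rw [hu, inv_mul_cancel_right₀ hθ]
  have hnu : ‖σ₂ u‖ = 1 := by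
    rw [hu, map_mul, map_inv₀, norm_mul, norm_inv, h, mul_inv_cancel₀ (norm_ne_zero_iff.mpr hσθ)]
  set q : ℚ := Algebra.norm ℚ u with hq
  have hN := norm_eq_mul_norm_sq σ₁ σ₂ hdeg hσ₂ u
  rw [hnu, one_pow, mul_one, ← hq] at hN
  -- `σ₁ u = q`, hence `u = q`
  have huq : u = (q : K) := σ₁.injective (by rw [map_ratCast, hN])
  have hq1 : |(q : ℝ)| = 1 := by
    have : ‖σ₂ (q : K)‖ = 1 := by rw [← huq]; exact hnu
    rwa [map_ratCast, Complex.norm_ratCast] at this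
  rcases abs_eq (zero_le_one) |>.mp hq1 with h1 | h1
  · left
    have hq' : q = 1 := by exact_mod_cast h1
    rw [hθ', huq, hq']; push_cast; ring
  · right
    have hq' : q = -1 := by exact_mod_cast h1
    rw [hθ', huq, hq']; push_cast; ring

/-- **Total order of the minima**: for two distinct minima with positive real conjugate, the one with
the smaller `σ₁` has the strictly larger `‖σ₂ ·‖`. [folklore] -/
theorem relMinima_lt_iff (hdeg : Module.finrank ℚ K = 3) (hσ₂ : ∃ z : K, starRingEnd ℂ (σ₂ z) ≠ σ₂ z)
    {θ θ' : K} (hθ : θ ∈ relMinima σ₁ σ₂ I) (hθ' : θ' ∈ relMinima σ₁ σ₂ I) (hp : 0 < σ₁ θ) (hp' : 0 < σ₁ θ')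
    (hne : θ ≠ θ') : σ₁ θ < σ₁ θ' ↔ ‖σ₂ θ'‖ < ‖σ₂ θ‖ := by
  have key : ∀ {a b : K}, a ∈ relMinima σ₁ σ₂ I → b ∈ relMinima σ₁ σ₂ I → 0 < σ₁ a → 0 < σ₁ b → a ≠ b →
      σ₁ a < σ₁ b → ‖σ₂ b‖ < ‖σ₂ a‖ := by
    intro a b ha hb hpa hpb hab hlt
    have hle : ‖σ₂ b‖ ≤ ‖σ₂ a‖ :=
      hb.2.2 a ha.1 ha.2.1 (by rwa [abs_of_pos hpa, abs_of_pos hpb])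
    refine lt_of_le_of_ne hle fun heq => ?_
    rcases eq_or_eq_neg_of_norm_eq σ₁ hdeg hσ₂ ha.2.1 heq with h | h
    · exact hab h.symm
    · rw [h, map_neg] at hpb; linarith
  refine ⟨key hθ hθ' hp hp' hne, fun h => ?_⟩
  rcases lt_trichotomy (σ₁ θ) (σ₁ θ') with hlt | heq | hgt
  · exact hlt
  · exact absurd (σ₁.injective heq) hne
  · exact absurd h (not_lt.mpr (key hθ' hθ hp' hp hne.symm hgt).le)

omit [NumberField K] in
/-- **Units act on the minima**: `u θ` is a minimum for every unit `u` of `𝓞 K`. [folklore] -/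
theorem unit_mul_mem_relMinima {θ : K} (h : θ ∈ relMinima σ₁ σ₂ I) (u : (𝓞 K)ˣ) :
    algebraMap (𝓞 K) K u * θ ∈ relMinima σ₁ σ₂ I := by
  have hu0 : algebraMap (𝓞 K) K u ≠ 0 := RingOfIntegers.coe_ne_zero_iff.mpr u.ne_zero
  have hmem : ∀ (v : 𝓞 K) {x : K}, x ∈ I → algebraMap (𝓞 K) K v * x ∈ I := fun v x hx => by
    rw [← Algebra.smul_def]
    exact (FractionalIdeal.mem_coe).mp (Submodule.smul_mem _ v ((FractionalIdeal.mem_coe).mpr hx))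
  refine ⟨hmem u h.1, mul_ne_zero hu0 h.2.1, fun φ hφ h0 hlt => ?_⟩
  have hinv : algebraMap (𝓞 K) K ((u⁻¹ : (𝓞 K)ˣ) : 𝓞 K) * algebraMap (𝓞 K) K u = 1 := by
    rw [← map_mul, Units.inv_mul, map_one]
  have hφφ : φ = algebraMap (𝓞 K) K u * (algebraMap (𝓞 K) K ((u⁻¹ : (𝓞 K)ˣ) : 𝓞 K) * φ) := by
    rw [← mul_assoc, mul_comm (algebraMap (𝓞 K) K (u : 𝓞 K)), hinv, one_mul]
  have hφ'I : algebraMap (𝓞 K) K ((u⁻¹ : (𝓞 K)ˣ) : 𝓞 K) * φ ∈ I := hmem _ hφ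
  have hφ'0 : algebraMap (𝓞 K) K ((u⁻¹ : (𝓞 K)ˣ) : 𝓞 K) * φ ≠ 0 :=
    mul_ne_zero (RingOfIntegers.coe_ne_zero_iff.mpr (u⁻¹).ne_zero) h0
  have hσu : 0 < |σ₁ (algebraMap (𝓞 K) K u)| := abs_pos.mpr ((map_ne_zero σ₁).mpr hu0)
  have hlt' : |σ₁ (algebraMap (𝓞 K) K ((u⁻¹ : (𝓞 K)ˣ) : 𝓞 K) * φ)| < |σ₁ θ| := by
    have h1 : |σ₁ φ| = |σ₁ (algebraMap (𝓞 K) K u)| *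
        |σ₁ (algebraMap (𝓞 K) K ((u⁻¹ : (𝓞 K)ˣ) : 𝓞 K) * φ)| := by
      conv_lhs => rw [hφφ]
      rw [map_mul, abs_mul]
    have h2 : |σ₁ (algebraMap (𝓞 K) K u * θ)| = |σ₁ (algebraMap (𝓞 K) K u)| * |σ₁ θ| := by
      rw [map_mul, abs_mul]
    rw [h1, h2] at hlt
    exact lt_of_mul_lt_mul_left hlt hσu.le
  have hle := h.2.2 _ hφ'I hφ'0 hlt'
  calc ‖σ₂ (algebraMap (𝓞 K) K u * θ)‖ = ‖σ₂ (algebraMap (𝓞 K) K u)‖ * ‖σ₂ θ‖ := by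
        rw [map_mul, norm_mul]
    _ ≤ ‖σ₂ (algebraMap (𝓞 K) K u)‖ * ‖σ₂ (algebraMap (𝓞 K) K ((u⁻¹ : (𝓞 K)ˣ) : 𝓞 K) * φ)‖ :=
        mul_le_mul_of_nonneg_left hle (norm_nonneg _)
    _ = ‖σ₂ φ‖ := by
        conv_rhs => rw [hφφ]
        simp only [map_mul, norm_mul]

end Minima

end Literature.NumberTheory.CubicFields
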